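import Literature.Probability.LatticeModels.VillainDirichletLimit
import HarnessLib

/-!
# `FrohlichSpencerVillainSpinWaveBound`: what is proved, and the exact remaining inputs

Status file for the named fact
`Literature.Probability.LatticeModels.FrohlichSpencerVillainSpinWaveBound` (`VillainSpinWave.lean`;
Dario–Wu 2020 Prop. 1.1 after Fröhlich–Spencer 1982), which has four clauses for the zero-boundary-
condition Villain rotator in `ℤ^d`, `d ≥ 3`: (i) the thermodynamic limit `G` of `⟨S_0·S_x⟩_{□_n,β,0}`
exists; (ii) clustering `|G − c₀| ≤ C/‖x‖^{d−2}`; (iii) `G ≤ exp(−(1/2β) g(x))`; (iv)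
`exp((−1/(2β) + o(1/β)) g(x)) ≤ G`, `g(x) = latticeGreen 0 − latticeGreen x`. The tree now PROVES
(i) for all `d ≥ 1`, `β > 0` (`tendsto_dirichletVillainTwoPoint_ciInf`, Ginibre pinning,
`VillainDirichletLimit.lean`) and (iii) for all `β > 0` (`le_exp_of_tendsto_dirichletVillainTwoPoint`,
exact duality, `VillainSpinWaveProofs.lean`). This file records, as a single reduction theorem, that
the fact follows from (ii) and (iv) stated for the proved limit `G_β(x) = inf_n ⟨S_0·S_x⟩_{□_n,β,0}`:
`FrohlichSpencerVillainSpinWaveBound_of_lowerBound_of_clustering`; and, using the duality formula of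
`VillainSpinWaveDuality.lean`, from (ii) and the FINITE-VOLUME vortex-gas estimate
`e^{r(β) g_n(x)} ∑_ξ g(ξ) ≤ ∑_ξ g(ξ) cos α(δ_0 − δ_x, ξ)` (eventually in `n`, `β r(β) → 0`):
`FrohlichSpencerVillainSpinWaveBound_of_vortexBound_of_clustering` — the form in which
Fröhlich–Spencer's renormalisation-group analysis would deliver it. The two hypotheses are
Fröhlich–Spencer's renormalisation-group estimates on the dual vortex gas (FS82 §§3–5 for spin
systems), not in the tree; they are the printed clauses themselves (hypotheses of a theorem, not new
named facts), so this is bookkeeping, not a discharge. Theorems only.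

## References

* [DarioWu2020] P. Dario, W. Wu, arXiv:2002.02946, Proposition 1.1 (PDF pp. 4–5).
* [FrohlichSpencerCMP1982] J. Fröhlich, T. Spencer, Comm. Math. Phys. 83 (1982) 411–454, §§3–5.
-/

noncomputable section

open MeasureTheory Measure Finset Function Set Filter
open scoped Topology
open Literature.MathematicalPhysics.QuantumFieldTheory
namespace Literature.Probability.LatticeModels

open DirichletVillain

/-- **What remains of the fact, exactly.** `FrohlichSpencerVillainSpinWaveBound` (Dario–Wu 2020
Prop. 1.1 after Fröhlich–Spencer 1982, as transcribed in `VillainSpinWave.lean`) FOLLOWS from the two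
clauses not yet in the tree, stated for the (proved) thermodynamic limit
`G_β(x) = inf_n ⟨S_0·S_x⟩_{□_n,β,0}` (`tendsto_dirichletVillainTwoPoint_ciInf`):
(iv) the spin-wave LOWER bound with `o(1/β)` correction — some `β₀ > 0` and `r` with `β r(β) → 0`
such that `exp((−1/(2β) + r(β)) (latticeGreen 0 − latticeGreen x)) ≤ G_β(x)` for `β > β₀` and all
`x` — and (ii) the CLUSTERING `|G_β(x) − c₀(β)| ≤ C(β)/‖x‖^{d−2}` (`x ≠ 0`) for `β` large; the
thermodynamic limit (i) and the upper bound (iii) are supplied by `VillainDirichletLimit.lean` and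
`VillainSpinWaveProofs.lean` for every `β > 0`. Both remaining inputs are Fröhlich–Spencer's
renormalisation-group analysis of the dual vortex gas (FS82 §§3–5; for the `U(1)` theory one degree
up the tree proves the analogous qualitative bound, `VillainPerimeterLaw.villain_perimeter_law`).
This is a reduction THEOREM (its hypotheses are the printed clauses themselves, not new named
facts); it is not a discharge. [cite: DarioWu2020, Proposition 1.1 (PDF pp. 4–5)] -/
theorem FrohlichSpencerVillainSpinWaveBound_of_lowerBound_of_clustering
    (hlow : ∀ d : ℕ, 3 ≤ d → ∃ β₀ : ℝ, 0 < β₀ ∧ ∃ r : ℝ → ℝ,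
      Tendsto (fun β : ℝ => β * r β) atTop (𝓝 0) ∧
        ∀ β : ℝ, β₀ < β → ∀ x : Site d,
          Real.exp ((-(1 / (2 * β)) + r β) * (latticeGreen (0 : Site d) - latticeGreen x)) ≤
            ⨅ n : ℕ, dirichletVillainTwoPoint β n x)
    (hclust : ∀ d : ℕ, 3 ≤ d → ∃ β₁ : ℝ, ∀ β : ℝ, β₁ < β → ∃ c₀ C : ℝ, ∀ x : Site d, x ≠ 0 →
      |(⨅ n : ℕ, dirichletVillainTwoPoint β n x) - c₀| ≤ C / ‖x‖ ^ (d - 2)) :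
    FrohlichSpencerVillainSpinWaveBound := by
  intro d hd
  obtain ⟨β₀, hβ₀, r, hr, hlow'⟩ := hlow d hd
  obtain ⟨β₁, hclust'⟩ := hclust d hd
  refine ⟨max β₀ β₁, lt_max_of_lt_left hβ₀, r, hr, fun β hβ => ?_⟩
  have hβ0 : β₀ < β := (le_max_left _ _).trans_lt hβ
  have hβ1 : β₁ < β := (le_max_right _ _).trans_lt hβ
  have hβpos : 0 < β := hβ₀.trans hβ0
  have hd1 : 0 < d := by omega
  obtain ⟨c₀, C, hc⟩ := hclust' β hβ1
  refine ⟨c₀, C, fun x => ⟨⨅ n : ℕ, dirichletVillainTwoPoint β n x,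
    tendsto_dirichletVillainTwoPoint_ciInf hd1 hβpos x, hc x, ?_, hlow' β hβ0 x⟩⟩
  exact le_exp_of_tendsto_dirichletVillainTwoPoint hd hβpos x
    (tendsto_dirichletVillainTwoPoint_ciInf hd1 hβpos x)

/-- **The remaining analytic input in finite volume: a lower bound on the vortex-gas average.**
By the duality formula (`VillainSpinWaveDuality`), in every cube
`⟨S_0·S_x⟩_{□_n,β,0} = e^{-g_n(x)/(2β)} · (∑_ξ g(ξ) cos α(q_x, ξ)) / (∑_ξ g(ξ))`, `q_x = δ_0 − δ_x`,
`g_n(x) = G_{□°}(0,0) + G_{□°}(x,x) − 2G_{□°}(0,x) → latticeGreen 0 − latticeGreen x`. Hence clause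
(iv) of the fact follows from: for `β > β₀` and every `x`, eventually in `n`,
`e^{r(β) g_n(x)} ∑_ξ g(ξ) ≤ ∑_ξ g(ξ) cos α(q_x, ξ)` with `β r(β) → 0` — Fröhlich–Spencer's estimate that
the dilute vortex gas renormalises the spin-wave stiffness by `o(1/β)` only (FS82 §§3–5). Together
with the clustering (ii) this gives the fact; (i) and (iii) are proved in the tree. A reduction
THEOREM, not a discharge. [cite: DarioWu2020, Proposition 1.1 (PDF pp. 4–5)] -/
theorem FrohlichSpencerVillainSpinWaveBound_of_vortexBound_of_clustering
    (hvortex : ∀ d : ℕ, 3 ≤ d → ∃ β₀ : ℝ, 0 < β₀ ∧ ∃ r : ℝ → ℝ,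
      Tendsto (fun β : ℝ => β * r β) atTop (𝓝 0) ∧
        ∀ β : ℝ, β₀ < β → ∀ x : Site d, ∀ᶠ n : ℕ in atTop,
          Real.exp (r β * greenForm n (fun a : SIdx d n =>
              (if (a : Site d) = 0 then (1 : ℤ) else 0) - (if (a : Site d) = x then (1 : ℤ) else 0))) *
            (∑' ξ : (EIdx d n → ℤ) ⧸ (gradZ (d := d) n).range, coulombWeight β ξ) ≤
          ∑' ξ : (EIdx d n → ℤ) ⧸ (gradZ (d := d) n).range, coulombWeight β ξ *
            Real.cos (vortexAngle n (fun a : SIdx d n =>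
              (if (a : Site d) = 0 then (1 : ℤ) else 0) - (if (a : Site d) = x then (1 : ℤ) else 0)) ξ.out))
    (hclust : ∀ d : ℕ, 3 ≤ d → ∃ β₁ : ℝ, ∀ β : ℝ, β₁ < β → ∃ c₀ C : ℝ, ∀ x : Site d, x ≠ 0 →
      |(⨅ n : ℕ, dirichletVillainTwoPoint β n x) - c₀| ≤ C / ‖x‖ ^ (d - 2)) :
    FrohlichSpencerVillainSpinWaveBound := by
  refine FrohlichSpencerVillainSpinWaveBound_of_lowerBound_of_clustering (fun d hd => ?_) hclust
  obtain ⟨β₀, hβ₀, r, hr, hv⟩ := hvortex d hd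
  refine ⟨β₀, hβ₀, r, hr, fun β hβ x => ?_⟩
  have hβpos : 0 < β := hβ₀.trans hβ
  have hd1 : 0 < d := by omega
  -- the finite-volume lower bound, eventually in `n`
  have hfin : ∀ᶠ n : ℕ in atTop,
      Real.exp ((-(1 / (2 * β)) + r β) * (dirichletGreen (box d n) 0 0 + dirichletGreen (box d n) x x -
          2 * dirichletGreen (box d n) 0 x)) ≤ dirichletVillainTwoPoint β n x := by
    filter_upwards [hv β hβ x] with n hn
    obtain ⟨hsw, hZ⟩ := setIntegral_weight_eq (d := d) (n := n) hd1 hβpos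
    have hZpos : 0 < ∑' ξ : (EIdx d n → ℤ) ⧸ (gradZ (d := d) n).range, coulombWeight β ξ :=
      hsw.tsum_pos (fun ξ => (coulombWeight_pos hd1 hβpos ξ).le) (QuotientAddGroup.mk 0)
        (coulombWeight_pos hd1 hβpos _)
    rw [dirichletVillainTwoPoint_eq_ratio, setIntegral_phase_mul_weight_eq hd1 hβpos, hZ, ← greenForm_twoPoint x,
      le_div_iff₀ hZpos, add_mul, Real.exp_add]
    have h1 : Real.exp (-(1 / (2 * β)) * greenForm n (fun a : SIdx d n =>
        (if (a : Site d) = 0 then (1 : ℤ) else 0) - (if (a : Site d) = x then (1 : ℤ) else 0))) =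
        Real.exp (-(greenForm n (fun a : SIdx d n =>
          (if (a : Site d) = 0 then (1 : ℤ) else 0) - (if (a : Site d) = x then (1 : ℤ) else 0))) / (2 * β)) := by
      congr 1; ring
    rw [h1, mul_assoc]
    exact mul_le_mul_of_nonneg_left hn (Real.exp_pos _).le
  -- pass to the limit `n → ∞`
  have hG := tendsto_dirichletVillainTwoPoint_ciInf hd1 hβpos x
  have hexp : Tendsto (fun n : ℕ => Real.exp ((-(1 / (2 * β)) + r β) *
      (dirichletGreen (box d n) 0 0 + dirichletGreen (box d n) x x - 2 * dirichletGreen (box d n) 0 x))) atTop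
      (𝓝 (Real.exp ((-(1 / (2 * β)) + r β) * (latticeGreen (0 : Site d) - latticeGreen x)))) :=
    (Real.continuous_exp.tendsto _).comp ((tendsto_dirichletGreen_twoPoint hd x).const_mul _)
  exact le_of_tendsto_of_tendsto hexp hG hfin

end Literature.Probability.LatticeModels
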